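import Summits.BirchSwinnertonDyer.Rank1Residual.F1Sign2.TwistedMinusSymbolSumProofs
import Mathlib.NumberTheory.LegendreSymbol.GaussEisensteinLemmas
import HarnessLib

/-!
# Cell `bsd-f1-sign2`, AN-33 PROOFS AWAY FROM `M` (§5♯): the Hecke step and the proportionality law for symbol units away from `M` — KERNEL-CHECKED (-an g16, Sketch_v37 §5)

PORT (cell `bsd-f1-sign2`, seat `-ty` g11) of -an g16's tree-rebased file of record `MEMO-an-data/g16/Sketch_v37.lean` 454eaaa5b944aeb6 (= MEMO-an v1.40 /
`Sketch_v36.lean` 335ae8cb61bfaf5b rebased on the tree: imports `F1Sign2/UnitDoorParityAtTwo` + `F1Sign2/TwistedMinusSymbolSumProofs`, the 37 decls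
byte-identical in the tree deleted, the v32-generalised «units AWAY from M» helpers renamed `…_away`; farm rc 0 · 0 err · 0 warn · 0 sorry,
`bc/Sketch_v37_check.json` 6d9656a1424da834; evidence #60 on stmt-23715).  REF1 §126 (refuter-bsd-f1-sign2-ref1 g11, 2026-08-28T17:18:39Z): «§4–§10 Away
generalisation clean; 29/29 new theorems axioms {propext, Classical.choice, Quot.sound}».  Typer edits = this header, the section ranges, added
docstrings on undocumented helpers; proofs VERBATIM.  Nothing here proves BSD; 23715 not closed.
Section §5 of the port file: `exists_int_doubleSum_eq_sub_away`, `exists_int_sum_mul_div_eq_away`, `minusHalfSumHeckeStep_away` (AN-33b for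
`IsMinusSymbolUnitAway f M u`, levels coprime to `M`), `minusHalfSumProportionality` (AN-33c away from `M`) and their local helpers; uses the tree's §5
lemmas (`sum_weight_mul_ratMinusSymbol`, `sum_Icc_natAbs_valMinAbs_mul_eq`, …, p646548) and the §2♯ carriers `IsMinusSymbolUnitAway`,
`exists_int_sum_ratMinusSymbol_eq_mul_away` (p654948).  [cite: MazurTateTeitelbaum1986, §I.4] [cite: MazurTate1987, §1]
-/

set_option autoImplicit false

noncomputable section

open scoped Classical MatrixGroups ModularForm

open CongruenceSubgroup WeierstrassCurve Literature.NumberTheory.EllipticCurves Literature.NumberTheory.EllipticCurves.ModularForms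

namespace Summit.BirchSwinnertonDyer.Rank1Residual.F1Sign2.ANg16

/-! ### §5 PROOFS (v26, g16 addendum): the Hecke step AN-33b (every odd level `m`) and the proportionality law AN-33c,
KERNEL-CHECKED from the tree's Hecke relation `intCast_mul_ratMinusSymbol` (MTT §I.4), the `1`-periodicity / oddness of `[·]⁻`
(`ratMinusSymbol_add_intCast`, `ratMinusSymbol_neg`), rationality `ratCast_ratMinusSymbol`, and the half-system permutation
`sum_Icc_natAbs_valMinAbs_mul_eq` (for a unit `a` of `ZMod m`, `m = 2h+1`, `k ↦ |a·k|` permutes `[1, h]`; Mathlib has the prime case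
`ZMod.Ico_map_valMinAbs_natAbs_eq_Ico_map_id`, the odd-modulus case is proved here from `ZMod.natCast_natAbs_valMinAbs`).  Route of proof:
sum the Hecke relation `a_q [k/m]⁻ = Σ_{j<q} [(k + jm)/(qm)]⁻ + [qk/m]⁻` over `1 ≤ k ≤ h = (m−1)/2`; the double sum is the
indicator-weighted full-range sum at level `qm`, which the reflection identity `Σ_{n<M} c_n [n/M]⁻ = Σ_{k≤H} (c_k − c_{M−k}) [k/M]⁻`
reduces `mod 2u` to `F_{qm} − F_q` (weights `±1` off the multiples of `m`, `0` on them); the last sum is `≡ F_m` by the permutation. -/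

section HalfSumProofs

open Finset

variable {N : ℕ} [NeZero N] (f : CuspForm (Gamma0 N) 2)

/-- LEMMA C: the double sum of the Hecke relation equals `F_{qp} − F_q (mod 2u)` (`p = 2h+1`, `q = 2h'+1`, `qp = 2H+1`). -/
theorem exists_int_doubleSum_eq_sub_away {M : ℕ} {u : ℚ} (hu : IsMinusSymbolUnitAway f M u) (p q H h h' : ℕ)
    (hHM : (2 * H + 1).Coprime M) (hp : p = 2 * h + 1) (hq : q = 2 * h' + 1) (hM : q * p = 2 * H + 1) :
    ∃ z : ℤ, ∑ k ∈ Icc 1 h, ∑ j ∈ range q, ratMinusSymbol f (((k + j * p : ℕ) : ℚ) / ((2 * H + 1 : ℕ) : ℚ)) =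
      ∑ k ∈ Icc 1 H, ratMinusSymbol f ((k : ℚ) / ((2 * H + 1 : ℕ) : ℚ))
        - ∑ i ∈ Icc 1 h', ratMinusSymbol f ((i : ℚ) / (q : ℚ)) + 2 * z * u := by
  have hp0 : 0 < p := by omega
  have hHp : H = p * h' + h := by
    have : 2 * H + 1 = 2 * (p * h' + h) + 1 := by rw [← hM, hp, hq]; ring
    omega
  have hpM : p ∣ 2 * H + 1 := by rw [← hM]; exact Dvd.intro_left q rfl
  -- (i) the double sum as a filtered sum over [1, 2H]
  have h1 : ∑ k ∈ Icc 1 h, ∑ j ∈ range q, ratMinusSymbol f (((k + j * p : ℕ) : ℚ) / ((2 * H + 1 : ℕ) : ℚ)) =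
      ∑ n ∈ (Icc 1 (2 * H)).filter (fun n => n % p ∈ Icc 1 h), ratMinusSymbol f ((n : ℚ) / ((2 * H + 1 : ℕ) : ℚ)) := by
    rw [← sum_product']
    refine sum_nbij' (fun x => x.1 + x.2 * p) (fun n => (n % p, n / p)) ?_ ?_ ?_ ?_ ?_
    · rintro ⟨k, j⟩ hx
      rw [mem_product, mem_Icc, mem_range] at hx
      obtain ⟨⟨hk1, hkh⟩, hjq⟩ := hx
      have hkp : k < p := by omega
      dsimp only
      rw [mem_filter, mem_Icc, Nat.add_mul_mod_self_right, Nat.mod_eq_of_lt hkp, mem_Icc]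
      refine ⟨⟨by omega, ?_⟩, hk1, hkh⟩
      have h2 : j * p ≤ (q - 1) * p := Nat.mul_le_mul_right p (by omega)
      have e : (q - 1) * p + p = q * p := by
        have : q - 1 = 2 * h' := by omega
        rw [this, hq]; ring
      omega
    · intro n hn
      rw [mem_filter, mem_Icc] at hn
      obtain ⟨⟨hn1, hn2⟩, hnP⟩ := hn
      rw [mem_product, mem_range]
      refine ⟨hnP, ?_⟩
      rw [Nat.div_lt_iff_lt_mul hp0]; omega
    · rintro ⟨k, j⟩ hx
      rw [mem_product, mem_Icc, mem_range] at hx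
      obtain ⟨⟨hk1, hkh⟩, hjq⟩ := hx
      have hkp : k < p := by omega
      refine Prod.ext ?_ ?_
      · show (k + j * p) % p = k
        rw [Nat.add_mul_mod_self_right, Nat.mod_eq_of_lt hkp]
      · show (k + j * p) / p = j
        rw [Nat.add_mul_div_right _ _ hp0, Nat.div_eq_of_lt hkp, zero_add]
    · intro n hn
      exact Nat.mod_add_div' n p
    · rintro ⟨k, j⟩ hx
      rfl
  -- (ii) filtered sum = weighted sum, then reflect
  have h2 : ∑ n ∈ (Icc 1 (2 * H)).filter (fun n => n % p ∈ Icc 1 h), ratMinusSymbol f ((n : ℚ) / ((2 * H + 1 : ℕ) : ℚ)) =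
      ∑ n ∈ Icc 1 (2 * H), ((if n % p ∈ Icc 1 h then (1 : ℤ) else 0 : ℤ) : ℚ) *
        ratMinusSymbol f ((n : ℚ) / ((2 * H + 1 : ℕ) : ℚ)) := by
    rw [sum_filter]
    refine sum_congr rfl fun n hn => ?_
    split_ifs <;> simp
  have h3 := sum_weight_mul_ratMinusSymbol f (fun n => if n % p ∈ Icc 1 h then (1 : ℤ) else 0) H
  -- (iii) termwise congruence with `b k := if p ∣ k then 0 else [k/M]⁻`
  have h4 : ∃ z : ℤ, ∑ k ∈ Icc 1 H, (((if k % p ∈ Icc 1 h then (1 : ℤ) else 0) -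
        (if (2 * H + 1 - k) % p ∈ Icc 1 h then (1 : ℤ) else 0) : ℤ) : ℚ) *
        ratMinusSymbol f ((k : ℚ) / ((2 * H + 1 : ℕ) : ℚ))
      - ∑ k ∈ Icc 1 H, (if p ∣ k then (0 : ℚ) else ratMinusSymbol f ((k : ℚ) / ((2 * H + 1 : ℕ) : ℚ))) = 2 * z * u := by
    refine exists_int_sum_sub_sum _ _ _ fun k hk => ?_
    rw [mem_Icc] at hk
    obtain ⟨z₀, hz₀⟩ := hu.2 ((k : ℚ) / ((2 * H + 1 : ℕ) : ℚ)) (den_natCast_div_natCast_coprime hHM k)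
    by_cases hpk : p ∣ k
    · have hk0 : ¬ (k % p ∈ Icc 1 h) := by
        rw [Nat.mod_eq_zero_of_dvd hpk, mem_Icc]; omega
      have hM0 : ¬ ((2 * H + 1 - k) % p ∈ Icc 1 h) := by
        rw [Nat.mod_eq_zero_of_dvd (Nat.dvd_sub hpM hpk), mem_Icc]; omega
      exact ⟨0, by rw [if_neg hk0, if_neg hM0, if_pos hpk]; push_cast; ring⟩
    · have hr0 : 0 < k % p := Nat.pos_of_ne_zero fun h0 => hpk (Nat.dvd_of_mod_eq_zero h0)
      have hrp : k % p < p := Nat.mod_lt k hp0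
      have hmodM : (2 * H + 1 - k) % p = p - k % p := sub_mod_eq_of_dvd hp0 hpM (by omega) hpk
      by_cases hlow : k % p ≤ h
      · have hwk : k % p ∈ Icc 1 h := by rw [mem_Icc]; omega
        have hwM : ¬ ((2 * H + 1 - k) % p ∈ Icc 1 h) := by rw [hmodM, mem_Icc]; omega
        exact ⟨0, by rw [if_pos hwk, if_neg hwM, if_neg hpk]; push_cast; ring⟩
      · have hwk : ¬ (k % p ∈ Icc 1 h) := by rw [mem_Icc]; omega
        have hwM : (2 * H + 1 - k) % p ∈ Icc 1 h := by rw [hmodM, mem_Icc]; omega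
        exact ⟨-z₀, by rw [if_neg hwk, if_pos hwM, if_neg hpk, hz₀]; push_cast; ring⟩
  -- (iv) the `b`-sum is `F_M` minus the multiples of `p`, and those give `F_q`
  have h5 : ∑ k ∈ Icc 1 H, (if p ∣ k then (0 : ℚ) else ratMinusSymbol f ((k : ℚ) / ((2 * H + 1 : ℕ) : ℚ))) =
      ∑ k ∈ (Icc 1 H).filter (fun k => ¬ p ∣ k), ratMinusSymbol f ((k : ℚ) / ((2 * H + 1 : ℕ) : ℚ)) := by
    rw [sum_filter]
    refine sum_congr rfl fun k hk => ?_
    split_ifs <;> simp_all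
  have h6 : ∑ k ∈ (Icc 1 H).filter (fun k => ¬ p ∣ k), ratMinusSymbol f ((k : ℚ) / ((2 * H + 1 : ℕ) : ℚ)) =
      ∑ k ∈ Icc 1 H, ratMinusSymbol f ((k : ℚ) / ((2 * H + 1 : ℕ) : ℚ))
        - ∑ k ∈ (Icc 1 H).filter (fun k => p ∣ k), ratMinusSymbol f ((k : ℚ) / ((2 * H + 1 : ℕ) : ℚ)) := by
    rw [eq_sub_iff_add_eq, add_comm, sum_filter_add_sum_filter_not]
  have hq0' : (q : ℚ) ≠ 0 := by rw [hq]; positivity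
  have hp0' : (p : ℚ) ≠ 0 := by rw [hp]; positivity
  have h7 : ∑ i ∈ Icc 1 h', ratMinusSymbol f ((i : ℚ) / (q : ℚ)) =
      ∑ k ∈ (Icc 1 H).filter (fun k => p ∣ k), ratMinusSymbol f ((k : ℚ) / ((2 * H + 1 : ℕ) : ℚ)) := by
    refine sum_nbij' (fun i => i * p) (fun k => k / p) ?_ ?_ ?_ ?_ ?_
    · intro i hi
      rw [mem_Icc] at hi
      rw [mem_filter, mem_Icc]
      have h1p : 1 * p ≤ i * p := Nat.mul_le_mul_right p hi.1
      have h2p : i * p ≤ h' * p := Nat.mul_le_mul_right p hi.2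
      have h3p : h' * p = p * h' := Nat.mul_comm _ _
      exact ⟨⟨by omega, by omega⟩, Dvd.intro_left i rfl⟩
    · intro k hk
      rw [mem_filter, mem_Icc] at hk
      obtain ⟨⟨hk1, hkH⟩, ⟨i, rfl⟩⟩ := hk
      rw [Nat.mul_div_cancel_left i hp0, mem_Icc]
      constructor
      · rcases Nat.eq_zero_or_pos i with rfl | hi0
        · simp at hk1
        · exact hi0
      · by_contra hle
        have h5 : p * (h' + 1) ≤ p * i := Nat.mul_le_mul_left p (by omega)
        have e : p * (h' + 1) = p * h' + p := by ring
        omega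
    · intro i hi
      exact Nat.mul_div_cancel i hp0
    · intro k hk
      rw [mem_filter] at hk
      exact Nat.div_mul_cancel hk.2
    · intro i hi
      congr 1
      rw [← hM]
      push_cast
      field_simp
      try ring
  obtain ⟨z, hz⟩ := h4
  refine ⟨z, ?_⟩
  rw [h1, h2, h3, h7]
  rw [h5, h6] at hz
  linarith

/-- LEMMA B: `∑_{k=1}^{h} [qk/m]⁻ ≡ F_m (mod 2u)` for `m = 2h+1` odd and `q` prime to `m` (half-system permutation). -/
theorem exists_int_sum_mul_div_eq_away {M : ℕ} {u : ℚ} (hu : IsMinusSymbolUnitAway f M u) {m : ℕ} (hmM : m.Coprime M) (h : ℕ)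
    (hmh : m = 2 * h + 1)
    {q : ℕ} (hqm : Nat.Coprime q m) :
    ∃ z : ℤ, ∑ k ∈ Icc 1 h, ratMinusSymbol f ((q : ℚ) * ((k : ℚ) / (m : ℚ))) =
      ∑ k ∈ Icc 1 h, ratMinusSymbol f ((k : ℚ) / (m : ℚ)) + 2 * z * u := by
  haveI : NeZero m := ⟨by omega⟩
  have hm' : (m : ℚ) ≠ 0 := by rw [hmh]; positivity
  have hab : (q : ZMod m) * (((ZMod.unitOfCoprime q hqm)⁻¹ : (ZMod m)ˣ) : ZMod m) = 1 := by
    rw [← ZMod.coe_unitOfCoprime q hqm]; exact (ZMod.unitOfCoprime q hqm).mul_inv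
  -- termwise: `[qk/m]⁻ ≡ [|v_k|/m]⁻ (mod 2u)` with `v_k` the absolutely least residue of `qk mod m`
  have ht : ∃ z : ℤ, ∑ k ∈ Icc 1 h, ratMinusSymbol f ((q : ℚ) * ((k : ℚ) / (m : ℚ)))
      - ∑ k ∈ Icc 1 h, ratMinusSymbol f (((((q : ZMod m) * k).valMinAbs.natAbs : ℕ) : ℚ) / (m : ℚ)) = 2 * z * u := by
    refine exists_int_sum_sub_sum _ _ _ fun k hk => ?_
    have hvz : ((((q : ZMod m) * k).valMinAbs : ℤ) : ZMod m) = (q : ZMod m) * k := ZMod.coe_valMinAbs _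
    have hdvd : (m : ℤ) ∣ (q : ℤ) * k - ((q : ZMod m) * k).valMinAbs := by
      rw [← ZMod.intCast_zmod_eq_zero_iff_dvd]
      push_cast
      simp
    obtain ⟨t, ht⟩ := hdvd
    have htQ : ((q : ℚ) * k - ((((q : ZMod m) * k).valMinAbs : ℤ) : ℚ)) = (m : ℚ) * (t : ℚ) := by
      exact_mod_cast ht
    have e1 : (q : ℚ) * ((k : ℚ) / (m : ℚ)) = ((((q : ZMod m) * k).valMinAbs : ℤ) : ℚ) / (m : ℚ) + ((t : ℤ) : ℚ) := by
      field_simp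
      linarith
    rw [e1, ratMinusSymbol_add_intCast]
    rcases Int.natAbs_eq (((q : ZMod m) * k).valMinAbs) with hc | hc
    · refine ⟨0, ?_⟩
      have : ((((q : ZMod m) * k).valMinAbs : ℤ) : ℚ) = ((((q : ZMod m) * k).valMinAbs.natAbs : ℕ) : ℚ) := by
        rw [hc]; simp
      rw [this]; simp
    · obtain ⟨z₀, hz₀⟩ := hu.2 (((((q : ZMod m) * k).valMinAbs.natAbs : ℕ) : ℚ) / (m : ℚ)) (den_natCast_div_natCast_coprime hmM _)
      refine ⟨-z₀, ?_⟩
      have : ((((q : ZMod m) * k).valMinAbs : ℤ) : ℚ) = -((((q : ZMod m) * k).valMinAbs.natAbs : ℕ) : ℚ) := by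
        rw [hc]; simp
      rw [this, neg_div, ratMinusSymbol_neg, hz₀]; push_cast; ring
  have hperm := sum_Icc_natAbs_valMinAbs_mul_eq h hmh (q : ZMod m) _ hab
    (fun n => ratMinusSymbol f ((n : ℚ) / (m : ℚ)))
  obtain ⟨z, hz⟩ := ht
  exact ⟨z, by rw [← hperm]; linarith⟩

/-- **AN-33b at every odd level (PROVED): the Hecke step `F_{qm} − (a_q − 1)·F_m − F_q ∈ 2uℤ`** for `m` odd, `q` an odd prime,
`q ∤ N`, `q ∤ m`. -/
theorem minusHalfSumHeckeStep_away (hf : IsNewform0 f) (hQ : coeffField f = ⊥) {M : ℕ} {u : ℚ} (hu : IsMinusSymbolUnitAway f M u)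
    {m q : ℕ} (hmM : m.Coprime M) (hqM : q.Coprime M) (hmo : Odd m) (hq : q.Prime) (hqo : Odd q) (hqN : ¬ q ∣ N) (hqm : ¬ q ∣ m)
    {aq : ℤ} (haq : cuspCoeff f q = (aq : ℂ)) :
    ∃ z : ℤ, minusHalfSum f (q * m) - (aq - 1) * minusHalfSum f m - minusHalfSum f q = 2 * z * u := by
  obtain ⟨h, hmh⟩ := hmo
  obtain ⟨h', hqh'⟩ := hqo
  haveI : NeZero q := ⟨hq.ne_zero⟩
  have hcop : Nat.Coprime q m := (Nat.Prime.coprime_iff_not_dvd hq).2 hqm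
  have hm0 : (m : ℚ) ≠ 0 := by rw [hmh]; positivity
  have hq0 : (q : ℚ) ≠ 0 := by exact_mod_cast hq.ne_zero
  have hM : q * m = 2 * (2 * h * h' + h + h') + 1 := by rw [hmh, hqh']; ring
  have eP : minusHalfSum f m = ∑ k ∈ Icc 1 h, ratMinusSymbol f ((k : ℚ) / (m : ℚ)) := by
    unfold minusHalfSum; rw [show (m - 1) / 2 = h by omega]
  have eQ : minusHalfSum f q = ∑ k ∈ Icc 1 h', ratMinusSymbol f ((k : ℚ) / (q : ℚ)) := by
    unfold minusHalfSum; rw [show (q - 1) / 2 = h' by omega]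
  have eM : minusHalfSum f (q * m) =
      ∑ k ∈ Icc 1 (2 * h * h' + h + h'), ratMinusSymbol f ((k : ℚ) / ((2 * (2 * h * h' + h + h') + 1 : ℕ) : ℚ)) := by
    unfold minusHalfSum; rw [hM, show (2 * (2 * h * h' + h + h') + 1 - 1) / 2 = 2 * h * h' + h + h' by omega]
  -- the Hecke relation, summed over `k ∈ [1, h]`
  have hrat := ratCast_ratMinusSymbol f hf hQ
  have hHecke : ∀ r : ℚ, (aq : ℚ) * ratMinusSymbol f r =
      ∑ j : Fin q, ratMinusSymbol f ((r + j) / q) + ratMinusSymbol f (q * r) :=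
    intCast_mul_ratMinusSymbol q hf hq hqN haq hrat
  have hA : (aq : ℚ) * minusHalfSum f m =
      ∑ k ∈ Icc 1 h, ∑ j ∈ range q, ratMinusSymbol f (((k + j * m : ℕ) : ℚ) / ((2 * (2 * h * h' + h + h') + 1 : ℕ) : ℚ))
        + ∑ k ∈ Icc 1 h, ratMinusSymbol f ((q : ℚ) * ((k : ℚ) / (m : ℚ))) := by
    rw [eP, mul_sum, ← sum_add_distrib]
    refine sum_congr rfl fun k hk => ?_
    rw [hHecke]
    congr 1
    rw [show (∑ j : Fin q, ratMinusSymbol f ((((k : ℚ) / (m : ℚ)) + j) / q)) =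
        ∑ j ∈ range q, ratMinusSymbol f ((((k : ℚ) / (m : ℚ)) + j) / q) from
      Fin.sum_univ_eq_sum_range (fun j : ℕ => ratMinusSymbol f ((((k : ℚ) / (m : ℚ)) + j) / q)) q]
    refine sum_congr rfl fun j hj => ?_
    congr 1
    rw [← hM]
    push_cast
    field_simp
    try ring
  obtain ⟨z₁, hz₁⟩ := exists_int_doubleSum_eq_sub_away f hu m q (2 * h * h' + h + h') h h'
    (by rw [← hM]; exact Nat.Coprime.mul_left hqM hmM) hmh hqh' hM
  obtain ⟨z₂, hz₂⟩ := exists_int_sum_mul_div_eq_away f hu hmM h hmh hcop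
  refine ⟨-(z₁ + z₂), ?_⟩
  rw [hz₁, hz₂, ← eM, ← eQ, ← eP] at hA
  push_cast
  linarith

/-- (v32) AN-33c for units away from `M`: `a_{q'}·F_q − a_q·F_{q'} ∈ 2uℤ` for odd primes `q ≠ q'` not dividing `N`, coprime to `M`. -/
theorem minusHalfSumProportionality (hf : IsNewform0 f) (hQ : coeffField f = ⊥) {M : ℕ} {u : ℚ} (hu : IsMinusSymbolUnitAway f M u)
    {q q' : ℕ} (hq : q.Prime) (hq' : q'.Prime) (hqo : Odd q) (hq'o : Odd q') (hne : q ≠ q') (hqN : ¬ q ∣ N) (hq'N : ¬ q' ∣ N)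
    (hqM : q.Coprime M) (hq'M : q'.Coprime M) {aq aq' : ℤ} (haq : cuspCoeff f q = (aq : ℂ)) (haq' : cuspCoeff f q' = (aq' : ℂ)) :
    ∃ z : ℤ, aq' * minusHalfSum f q - aq * minusHalfSum f q' = 2 * z * u := by
  have hqq' : ¬ q ∣ q' := fun hd => hne ((Nat.prime_dvd_prime_iff_eq hq hq').1 hd)
  have hq'q : ¬ q' ∣ q := fun hd => hne ((Nat.prime_dvd_prime_iff_eq hq' hq).1 hd).symm
  obtain ⟨z₁, hz₁⟩ := minusHalfSumHeckeStep_away f hf hQ hu hq'M hqM hq'o hq hqo hqN hqq' haq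
  obtain ⟨z₂, hz₂⟩ := minusHalfSumHeckeStep_away f hf hQ hu hqM hq'M hqo hq' hq'o hq'N hq'q haq'
  have hcomm : (q' * q : ℕ) = q * q' := Nat.mul_comm _ _
  rw [hcomm] at hz₂
  obtain ⟨a, ha⟩ := exists_int_minusHalfSum_eq_mul_away hu q hqM
  obtain ⟨b, hb⟩ := exists_int_minusHalfSum_eq_mul_away hu q' hq'M
  refine ⟨z₁ - z₂ - b + a, ?_⟩
  have e : aq' * minusHalfSum f q - aq * minusHalfSum f q' =
      (minusHalfSum f (q * q') - (aq - 1) * minusHalfSum f q' - minusHalfSum f q) -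
        (minusHalfSum f (q * q') - (aq' - 1) * minusHalfSum f q - minusHalfSum f q') -
        2 * minusHalfSum f q' + 2 * minusHalfSum f q := by ring
  rw [e, hz₁, hz₂, ha, hb]; push_cast; ring

end HalfSumProofs

end Summit.BirchSwinnertonDyer.Rank1Residual.F1Sign2.ANg16
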